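/-
Copyright (c) 2026 the pub-hodgecm-mathlib formalisation cell (harness21).  Prover seat hodgecm-mathlib-K2Liu-p01 (g8), Track B «K2-LIT»,
#184♮ = hLiu418 = `stmt-HodgeConjecture-24832`; #42S organ S1 ROAD W, F7 LAST-FILE letter `hDW` (bus 12:4xZ decomposition, NOTES «phase∕duality consolidation»):
the HERMITIAN-TEST form of trace duality — `(∀ H hermitian, tr(H G) ∈ I) ↔ G ∈ I entrywise` for hermitian `G` — the inert companion of ★ K2Liu-p08 (g4)
`K2LiuTraceDualityMatrixBox.forall_trace_mul_mem_iff` (all `Y` as tests, split road).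
-/
import Summits.HodgeConjecture.HodgeConjecture.Theorems.K2LiuHermitianTraceDuality   -- ★ (i-c) `forall_add_map_mul_mem_iff`, `add_map_mul_mem_of_mem`
import Mathlib.LinearAlgebra.Matrix.Trace
import HarnessLib

/-!
# Crux `HLiu418`, #42S-S1 ROAD W, letter (hDW-alg): TRACE SELF-DUALITY OF `Herm_n(𝒪_E)` —
# for hermitian `G`: `(∀ H hermitian, tr(H·G) ∈ I) ↔ ∀ i j, G i j ∈ I`

Cell `hodgecm-mathlib`, crux item hLiu418 = `stmt-HodgeConjecture-24832` (helper lane `--supports … --as helper`, count-neutral).  THEOREMS ONLY (no `def`, no instance,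
no notation, no named-fact hypothesis, no `sorry`).  GENERIC: comm ring `O`, involution `σ` with `σa − a` a unit for some `a` (unramified), `σ`-stable ideal `I`.

WHY (NOTES «phase∕duality consolidation»; SPEC-F7-FrameStep §1).  With `e(t,x) = ψ_v(−d⁻¹·tr(H_t G̃))`, `H_t = δ̂·𝕋₀t` HERMITIAN for skew `t` (★ (i-b) `herm_delta_smul_gramS_mul`)
and `G̃` the hermitian Gram of `b = φx`, the boxes `𝔰_{Λ_m} = {t ∣ H_t ∈ ϖ^{c₀−m}Herm_n(𝒪_E)}` give, through ★ (i-a) `forall_eq_one_const_mul_comp_iff`, the condition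
`∀ H ∈ Herm_n(𝒪_E), tr(H G̃) ∈ 𝔭^m` — and THIS file turns it into `G̃ ∈ ϖ^m Herm_n(𝒪_E)` (the cell condition of ★ (T3-core) ∕ ★ (iii-b)), in every residue characteristic (the
tests are the hermitian `E_ii` and `uE_ij + σ(u)E_ji`, decided by ★ (i-c)'s rank-one duality; no `2` appears):
* `trace_mul_eq_sum` (`tr(HG) = Σ_i Σ_j H i j G j i`), `trace_single_diag_mul`, `trace_offdiag_test_mul` (the two test values),
* `herm_single_diag`, `herm_offdiag_test` (the tests ARE hermitian), `trace_herm_mul_mem_of_forall_mem` (the easy direction),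
* **`forall_trace_herm_mul_mem_iff`** — the statement.
[Jacobowitz1962, §4] [Shimura1997, §13.2] [Weil1964, §20].
HONEST LABEL.  Count-neutral helper; `HC_CM` is proved only modulo the 7 printed citations (2 remaining named inputs: hLiu418 = `stmt-HodgeConjecture-24832`,
h413 = `stmt-HodgeConjecture-24833`) until rung 0 closes.

## References
* [Jacobowitz1962] R. Jacobowitz, *Hermitian forms over local fields*, Amer. J. Math. 84 (1962), §4.
* [Shimura1997] G. Shimura, *Euler Products and Eisenstein Series*, CBMS 93 (1997), §13.2.
* [Weil1964] A. Weil, Acta Math. 111 (1964), §20.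
-/

set_option autoImplicit false
set_option linter.dupNamespace false -- the mandated namespace repeats `HodgeConjecture.HodgeConjecture`

open Matrix

namespace Summit.HodgeConjecture.HodgeConjecture.Cruxes.HLiu418.K2LiuHermitianTraceSelfDuality

open K2LiuHermitianTraceDuality

variable {O : Type*} [CommRing O] (σ : O →+* O) (hσ : ∀ x, σ (σ x) = x) {a : O} (ha : IsUnit (σ a - a)) {I : Ideal O} (hI : ∀ x ∈ I, σ x ∈ I)
  {n : Type*} [Fintype n] [DecidableEq n]

/-! ## §1 The trace pairing and the two hermitian tests -/

omit [DecidableEq n] in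
/-- `tr(H·G) = Σ_i Σ_j H i j · G j i`. [folklore] -/
theorem trace_mul_eq_sum (H G : Matrix n n O) : trace (H * G) = ∑ i, ∑ j, H i j * G j i := by
  simp only [trace, diag_apply, mul_apply]

/-- the diagonal test: `tr(E_ii · G) = G i i`. [folklore] -/
theorem trace_single_diag_mul (G : Matrix n n O) (i : n) : trace (single i i (1 : O) * G) = G i i := by
  rw [trace_single_mul, smul_eq_mul, one_mul]

/-- the off-diagonal test: `tr((uE_ij + σ(u)E_ji) · G) = u·G j i + σ(u)·G i j`. [folklore] -/
theorem trace_offdiag_test_mul (G : Matrix n n O) (i j : n) (u : O) :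
    trace ((single i j u + single j i (σ u)) * G) = u * G j i + σ u * G i j := by
  rw [Matrix.add_mul, trace_add, trace_single_mul, trace_single_mul, smul_eq_mul, smul_eq_mul]

omit [Fintype n] in
/-- `E_ii` is hermitian. [folklore] -/
theorem herm_single_diag (i k l : n) : σ (single i i (1 : O) k l) = single i i (1 : O) l k := by
  simp only [single_apply, apply_ite σ, map_one, map_zero]
  congr 1
  simp only [and_comm]

omit [Fintype n] in
include hσ in
/-- `uE_ij + σ(u)E_ji` is hermitian. [folklore] -/
theorem herm_offdiag_test (i j : n) (u : O) (k l : n) :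
    σ ((single i j u + single j i (σ u)) k l) = (single i j u + single j i (σ u)) l k := by
  simp only [add_apply, single_apply, map_add, apply_ite σ, map_zero, hσ]
  rw [add_comm]
  congr 1 <;> simp only [and_comm]

/-! ## §2 The self-duality -/

omit [DecidableEq n] in
/-- the easy direction: `G` entrywise in `I` ⇒ `tr(H·G) ∈ I` for EVERY `H`. [folklore] -/
theorem trace_mul_mem_of_forall_mem {G : Matrix n n O} (hG : ∀ i j, G i j ∈ I) (H : Matrix n n O) : trace (H * G) ∈ I := by
  rw [trace_mul_eq_sum]
  exact I.sum_mem fun i _ => I.sum_mem fun j _ => I.mul_mem_left _ (hG j i)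

include hσ ha hI in
/-- **TRACE SELF-DUALITY OF `Herm_n(𝒪_E)` MODULO `I`**: for hermitian `G` (`σ (G i j) = G j i`), `(∀ H hermitian, tr(H·G) ∈ I) ↔ ∀ i j, G i j ∈ I` — the tests `E_ii` give the
diagonal, the tests `uE_ij + σ(u)E_ji` give `u·G j i + σ(u·G j i) ∈ I ∀ u`, i.e. `G j i ∈ I` by ★ (i-c). [cite: Jacobowitz1962, §4] [cite: Shimura1997, §13.2] -/
theorem forall_trace_herm_mul_mem_iff {G : Matrix n n O} (hG : ∀ i j, σ (G i j) = G j i) :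
    (∀ H : Matrix n n O, (∀ k l, σ (H k l) = H l k) → trace (H * G) ∈ I) ↔ ∀ i j, G i j ∈ I := by
  refine ⟨fun h => ?_, fun hG' H _ => trace_mul_mem_of_forall_mem hG' H⟩
  refine (forall_entry_mem_iff_of_herm σ hσ ha hI hG).1 ⟨fun i => ?_, fun i j hij u => ?_⟩
  · rw [← trace_single_diag_mul G i]
    exact h _ (herm_single_diag σ i)
  · have ht := h _ (herm_offdiag_test σ hσ i j u)
    rw [trace_offdiag_test_mul] at ht
    -- `u·G j i + σ(u)·G i j = u·G j i + σ(u·G j i)` since `G i j = σ (G j i)`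
    rwa [show σ u * G i j = σ (u * G j i) by rw [map_mul, hG j i]] at ht

include hσ ha hI in
/-- scalar variant (the `−d⁻¹`∕`ϖ^{c₀−m}` constants of the phase are absorbed by the caller via ★ (i-a); here `c·tr(H G)` with `c` fixed): for hermitian `G`,
`(∀ H hermitian, c·tr(H·G) ∈ I) ↔ ∀ i j, c·G i j ∈ I` when `σ c = c`. [cite: Shimura1997, §13.2] -/
theorem forall_mul_trace_herm_mul_mem_iff {c : O} (hc : σ c = c) {G : Matrix n n O} (hG : ∀ i j, σ (G i j) = G j i) :
    (∀ H : Matrix n n O, (∀ k l, σ (H k l) = H l k) → c * trace (H * G) ∈ I) ↔ ∀ i j, c * G i j ∈ I := by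
  have e : ∀ H : Matrix n n O, c * trace (H * G) = trace (H * (c • G)) := fun H => by rw [Matrix.mul_smul, trace_smul, smul_eq_mul]
  have hG' : ∀ i j, σ ((c • G) i j) = (c • G) j i := fun i j => by rw [smul_apply, smul_apply, smul_eq_mul, smul_eq_mul, map_mul, hc, hG]
  simp only [e, forall_trace_herm_mul_mem_iff σ hσ ha hI hG', smul_apply, smul_eq_mul]

end Summit.HodgeConjecture.HodgeConjecture.Cruxes.HLiu418.K2LiuHermitianTraceSelfDuality
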